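import Summits.HubbardSuperconductivity.HubbardSuperconductivity.Theses.LogColdTorus
import Literature.Probability.LatticeModels.NVectorInfraredBoundProofs
import Literature.Probability.LatticeModels.CycleMomentumEstimates
import Literature.MathematicalPhysics.QuantumLattice.LatticeToriProofs

/-!
# Route `LogColdTorus`, support `LogColdXYCalibration` (item `stmt-HubbardSuperconductivity-8810`)

CLASSICAL CALIBRATION — Mermin–Wagner's logarithm is a constant at `β = κ log L`: for every nonzero
finite compactly supported single-spin law `ρ` on `ℝ²` with `‖S‖ = 1` a.s., every `κ ≥ 2`, every
even `L ≥ 4` and every `β ≥ κ log L`, the `ν = 2` vector model on `(ℤ/Lℤ)²` has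
`⟨‖m_L‖²⟩_{L;β} ≥ 1/2`. Proof: clause (2) of the tree's PROVED infrared bound
`FriedliVelenik2017_nVector_infraredBound_holds` gives `⟨‖m_L‖²⟩ ≥ 1 - (2/4β)·S_L`,
`S_L = L⁻² Σ_{k≠0} 1/ε(2πk/L)`; Jordan's inequality on the cycle
(`eight_mul_sq_div_sq_le_one_sub_cos`) gives `ε(2πk/L) ≥ 8‖k‖²/L²` (`‖k‖` the periodic sup-norm
`torusNorm`), radial summation (`sum_radial_le`, spheres `≤ 8r + 4`) gives
`S_L ≤ Σ_{r=1}^{L/2} (1/r + 1/(2r²)) ≤ 2 + log(L/2)` (`harmonic_le_one_add_log`,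
`sum_Ioo_inv_sq_le`), and `2 + log(L/2) ≤ 2 log L` for `L ≥ 4` (`log 2 > 2/3`); hence
`S_L ≤ 2 log L ≤ β` and `⟨‖m_L‖²⟩ ≥ 1 - 1/2`.

Sources: S. Friedli, Y. Velenik, *Statistical Mechanics of Lattice Systems* (2017), Thm. 10.24 and
§10.5.2; J. Fröhlich, B. Simon, T. Spencer, CMP 50 (1976) 79, Thm. 3.1.
-/

set_option linter.dupNamespace false

noncomputable section

namespace Summit.HubbardSuperconductivity.HubbardSuperconductivity.Theorems.LogColdTorus

open Finset MeasureTheory Literature.Probability.LatticeModels Literature.MathematicalPhysics.QuantumLattice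
open Summit.HubbardSuperconductivity.HubbardSuperconductivity.Theses.LogColdTorus

variable {L : ℕ} [NeZero L]

/-- A nonzero point of the torus `(ℤ/Lℤ)^d` has periodic sup-norm at least `1`.
(Friedli–Velenik 2017, §3.1.) [folklore] -/
theorem one_le_torusNorm_of_ne_zero {d : ℕ} {k : TorusSite d L} (hk : k ≠ 0) :
    1 ≤ torusNorm k := by
  by_contra h
  apply hk
  funext i
  have hle : min (k i).val (L - (k i).val) ≤ torusNorm k :=
    Finset.le_sup (f := fun i => min (k i).val (L - (k i).val)) (Finset.mem_univ i)
  have hlt : (k i).val < L := ZMod.val_lt (k i)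
  have h0 : (k i).val = 0 := by omega
  exact (ZMod.val_eq_zero (k i)).mp h0

/-- The periodic sup-norm on `(ℤ/Lℤ)^d` is at most `L/2`. (Friedli–Velenik 2017, §3.1.) [folklore] -/
theorem torusNorm_le_half {d : ℕ} (k : TorusSite d L) : torusNorm k ≤ L / 2 := by
  refine Finset.sup_le fun i _ => ?_
  have := ZMod.val_lt (k i)
  show min (k i).val (L - (k i).val) ≤ L / 2
  omega

/-- **Jordan's inequality for the lattice dispersion on `(ℤ/Lℤ)²`**:
`ε(2πk/L) = Σᵢ (1 - cos(2πkᵢ/L)) ≥ 8‖k‖²/L²`, `‖k‖` the periodic sup-norm (each coordinate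
contributes `≥ 8 min(kᵢ, L - kᵢ)²/L²`, `eight_mul_sq_div_sq_le_one_sub_cos`).
(Friedli–Velenik 2017, §8.4; folklore.) [folklore] -/
theorem dispersion_latticeMomentum_ge (k : TorusSite 2 L) :
    8 * (torusNorm k : ℝ) ^ 2 / (L : ℝ) ^ 2 ≤ dispersion (latticeMomentum L k) := by
  have hcoord : ∀ i : Fin 2, 8 * ((min (k i).val (L - (k i).val) : ℕ) : ℝ) ^ 2 / (L : ℝ) ^ 2 ≤
      1 - Real.cos (latticeMomentum L k i) := by
    intro i
    show _ ≤ 1 - Real.cos (2 * Real.pi * ((k i).val : ℝ) / L)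
    rcases le_or_gt (2 * (k i).val) L with h | h
    · rw [min_eq_left (by omega)]
      exact eight_mul_sq_div_sq_le_one_sub_cos h
    · rw [min_eq_right (by omega)]
      exact eight_mul_sq_div_sq_le_one_sub_cos' (ZMod.val_lt _).le h.le
  obtain ⟨i₀, -, hi₀⟩ := Finset.exists_mem_eq_sup (Finset.univ : Finset (Fin 2))
    ⟨0, Finset.mem_univ _⟩ (fun i => min (k i).val (L - (k i).val))
  have hn : torusNorm k = min (k i₀).val (L - (k i₀).val) := hi₀
  calc 8 * (torusNorm k : ℝ) ^ 2 / (L : ℝ) ^ 2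
      = 8 * ((min (k i₀).val (L - (k i₀).val) : ℕ) : ℝ) ^ 2 / (L : ℝ) ^ 2 := by rw [hn]
    _ ≤ 1 - Real.cos (latticeMomentum L k i₀) := hcoord i₀
    _ ≤ ∑ i, (1 - Real.cos (latticeMomentum L k i)) :=
        Finset.single_le_sum (f := fun i => 1 - Real.cos (latticeMomentum L k i))
          (fun i _ => sub_nonneg.mpr (Real.cos_le_one _)) (Finset.mem_univ i₀)
    _ = dispersion (latticeMomentum L k) := rfl

/-- Off the zero mode, `L⁻² · ε(2πk/L)⁻¹ ≤ 1/(8‖k‖²)`. [folklore] -/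
theorem inv_sq_mul_inv_dispersion_le {k : TorusSite 2 L} (hk : k ≠ 0) :
    1 / (L : ℝ) ^ 2 * (1 / dispersion (latticeMomentum L k)) ≤ 1 / (8 * (torusNorm k : ℝ) ^ 2) := by
  have hL : (0 : ℝ) < L := by exact_mod_cast Nat.pos_of_ne_zero (NeZero.ne L)
  have hr : (1 : ℝ) ≤ torusNorm k := by exact_mod_cast one_le_torusNorm_of_ne_zero hk
  have hr0 : (0 : ℝ) < torusNorm k := by linarith
  have h8 : 0 < 8 * (torusNorm k : ℝ) ^ 2 / (L : ℝ) ^ 2 := by positivity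
  have hε := dispersion_latticeMomentum_ge k
  calc 1 / (L : ℝ) ^ 2 * (1 / dispersion (latticeMomentum L k))
      ≤ 1 / (L : ℝ) ^ 2 * (1 / (8 * (torusNorm k : ℝ) ^ 2 / (L : ℝ) ^ 2)) :=
        mul_le_mul_of_nonneg_left (one_div_le_one_div_of_le h8 hε) (by positivity)
    _ = 1 / (8 * (torusNorm k : ℝ) ^ 2) := by
        rw [one_div_div, ← mul_div_assoc, one_div_mul_cancel (by positivity)]

/-- `Σ_{r=1}^{n} (1/r + 1/(2r²)) ≤ 2 + log n` (`H_n ≤ 1 + log n`, Mathlib `harmonic_le_one_add_log`;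
`Σ 1/r² ≤ 2`, Mathlib `sum_Ioo_inv_sq_le`). [folklore] -/
theorem sum_Icc_inv_add_inv_sq_le (n : ℕ) :
    ∑ r ∈ Finset.Icc 1 n, (1 / (r : ℝ) + 1 / (2 * (r : ℝ) ^ 2)) ≤ 2 + Real.log n := by
  rw [Finset.sum_add_distrib]
  have h1 : ∑ r ∈ Finset.Icc 1 n, 1 / (r : ℝ) ≤ 1 + Real.log n := by
    have h := harmonic_le_one_add_log n
    rw [harmonic_eq_sum_Icc, Rat.cast_sum] at h
    refine le_trans (le_of_eq (Finset.sum_congr rfl fun r _ => ?_)) h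
    rw [Rat.cast_inv, Rat.cast_natCast, one_div]
  have h2 : ∑ r ∈ Finset.Icc 1 n, 1 / (2 * (r : ℝ) ^ 2) ≤ 1 := by
    have h := sum_Ioo_inv_sq_le (α := ℝ) 0 (n + 1)
    have hI : Finset.Ioo 0 (n + 1) = Finset.Icc 1 n := by
      ext r; simp only [Finset.mem_Ioo, Finset.mem_Icc]; omega
    rw [hI, Nat.cast_zero, zero_add, div_one] at h
    calc ∑ r ∈ Finset.Icc 1 n, 1 / (2 * (r : ℝ) ^ 2)
        = (1 / 2) * ∑ r ∈ Finset.Icc 1 n, ((r : ℝ) ^ 2)⁻¹ := by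
          rw [Finset.mul_sum]
          refine Finset.sum_congr rfl fun r _ => ?_
          ring
      _ ≤ (1 / 2) * 2 := mul_le_mul_of_nonneg_left h (by norm_num)
      _ = 1 := by norm_num
  linarith

/-- **The thermal infrared tail in `d = 2` is a logarithm**: for even `L ≥ 4`,
`S_L = L⁻² Σ_{k ≠ 0} ε(2πk/L)⁻¹ ≤ 2 log L` (`ε ≥ 8‖k‖²/L²`, spheres `#{‖k‖ = r} ≤ 8r + 4`,
`Σ_{r ≤ L/2} (1/r + 1/(2r²)) ≤ 2 + log(L/2) ≤ 2 log L`). This is the sum whose divergence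
`≈ log L/π` makes the fixed-`β` infrared bound fail in two dimensions and close at `β = κ log L`.
(Friedli–Velenik 2017, §10.5.2 and Exercise 10.16.) [folklore] -/
theorem inv_sq_mul_sum_inv_dispersion_le (hev : Even L) (h4 : 4 ≤ L) :
    1 / (L : ℝ) ^ 2 * ∑ k ∈ Finset.univ.erase (0 : TorusSite 2 L),
        1 / dispersion (latticeMomentum L k) ≤ 2 * Real.log L := by
  classical
  set F : ℕ → ℝ := fun r => if r ≤ L / 2 then 1 / (8 * (r : ℝ) ^ 2) else 0 with hFdef
  have hF : ∀ r, 0 ≤ F r := fun r => by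
    simp only [hFdef]
    split_ifs <;> positivity
  -- pointwise domination and extension to all of the torus
  have h12 : 1 / (L : ℝ) ^ 2 * ∑ k ∈ univ.erase (0 : TorusSite 2 L),
      1 / dispersion (latticeMomentum L k) ≤ ∑ k : TorusSite 2 L, F (torusDist k 0) := by
    rw [Finset.mul_sum]
    calc ∑ k ∈ univ.erase (0 : TorusSite 2 L), 1 / (L : ℝ) ^ 2 * (1 / dispersion (latticeMomentum L k))
        ≤ ∑ k ∈ univ.erase (0 : TorusSite 2 L), F (torusDist k 0) := by
          refine Finset.sum_le_sum fun k hk => ?_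
          have hk0 : k ≠ 0 := Finset.ne_of_mem_erase hk
          have hdist : torusDist k 0 = torusNorm k := by simp [torusDist]
          rw [hdist, hFdef]
          dsimp only
          rw [if_pos (torusNorm_le_half k)]
          exact inv_sq_mul_inv_dispersion_le hk0
      _ ≤ ∑ k : TorusSite 2 L, F (torusDist k 0) :=
          Finset.sum_le_sum_of_subset_of_nonneg (Finset.erase_subset _ _) fun k _ _ => hF _
  -- radial summation with the sphere bound `#{dist = r} ≤ 2·2·(2r+1)`
  have h3 : ∑ k : TorusSite 2 L, F (torusDist k 0) ≤
      ∑ r ∈ Finset.range L, ((2 * (2 * (2 * r + 1) ^ (2 - 1)) : ℕ) : ℝ) * F r :=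
    sum_radial_le F hF 0 (card_filter_torusDist_eq_le two_pos 0) (fun u => torusDist_lt u 0)
  -- evaluation of the radial sum
  have hstep4 : ∑ r ∈ Finset.range L, ((2 * (2 * (2 * r + 1) ^ (2 - 1)) : ℕ) : ℝ) * F r ≤
      ∑ r ∈ Finset.Icc 1 (L / 2), (1 / (r : ℝ) + 1 / (2 * (r : ℝ) ^ 2)) := by
    have hIcc : Finset.Icc 1 (L / 2) = (Finset.range L).filter (fun r => 1 ≤ r ∧ r ≤ L / 2) := by
      ext r
      simp only [Finset.mem_Icc, Finset.mem_filter, Finset.mem_range]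
      omega
    rw [hIcc, Finset.sum_filter]
    refine Finset.sum_le_sum fun r _ => ?_
    by_cases hr0 : r = 0
    · subst hr0
      have hP : ¬ (1 ≤ 0 ∧ 0 ≤ L / 2) := by omega
      rw [if_neg hP]
      simp [hFdef]
    · by_cases hrh : r ≤ L / 2
      · have hP : 1 ≤ r ∧ r ≤ L / 2 := ⟨Nat.one_le_iff_ne_zero.mpr hr0, hrh⟩
        rw [if_pos hP]
        simp only [hFdef, if_pos hrh]
        have hr' : (r : ℝ) ≠ 0 := by exact_mod_cast hr0
        apply le_of_eq
        push_cast
        simp only [pow_one]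
        field_simp
        ring
      · have hP : ¬ (1 ≤ r ∧ r ≤ L / 2) := fun h => hrh h.2
        rw [if_neg hP]
        simp only [hFdef, if_neg hrh, mul_zero, le_refl]
  -- harmonic numbers
  have h5 := sum_Icc_inv_add_inv_sq_le (L / 2)
  -- `2 + log (L/2) ≤ 2 log L` for `L ≥ 4`
  obtain ⟨m, hm⟩ := hev
  have hm2 : L / 2 = m := by omega
  have hL4 : (4 : ℝ) ≤ L := by exact_mod_cast h4
  have hLpos : (0 : ℝ) < L := by linarith
  have hmR : ((L / 2 : ℕ) : ℝ) = (L : ℝ) / 2 := by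
    rw [hm2]
    have : (L : ℝ) = m + m := by exact_mod_cast hm
    linarith
  rw [hmR, Real.log_div hLpos.ne' (by norm_num)] at h5
  have hlog2 := Real.log_two_gt_d9
  have hlog4 : 2 * Real.log 2 ≤ Real.log L := by
    have h := Real.log_le_log (by norm_num) hL4
    have e : Real.log 4 = 2 * Real.log 2 := by
      rw [show (4 : ℝ) = 2 ^ 2 by norm_num, Real.log_pow]
      norm_num
    linarith
  linarith

/-- **`LogColdXYCalibration` holds** (route `LogColdTorus`, support item
`stmt-HubbardSuperconductivity-8810`): for the `ν = 2` vector models on `(ℤ/Lℤ)²` with `‖S‖ = 1`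
a.s., `κ ≥ 2`, even `L ≥ 4` and `β ≥ κ log L`, `⟨‖m_L‖²⟩_{L;β} ≥ 1/2` — magnetisation long-range
order uniform in `L` and in `β ∈ [κ log L, ∞)`. Friedli–Velenik (2017) Thm. 10.24, clause (2),
with the two-dimensional thermal tail `S_L ≤ 2 log L ≤ β`. -/
theorem logColdXYCalibration_proof : LogColdXYCalibration := by
  intro ρ _ hK hρ hS κ hκ L _ hev h4 β hβ
  have hL4 : (4 : ℝ) ≤ L := by exact_mod_cast h4
  have hLpos : (0 : ℝ) < L := by linarith
  have hlog2 := Real.log_two_gt_d9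
  have hlog4 : 2 * Real.log 2 ≤ Real.log L := by
    have h := Real.log_le_log (by norm_num) hL4
    have e : Real.log 4 = 2 * Real.log 2 := by
      rw [show (4 : ℝ) = 2 ^ 2 by norm_num, Real.log_pow]
      norm_num
    linarith
  have hlogpos : 0 < Real.log L := by linarith
  have hκlog : 2 * Real.log L ≤ κ * Real.log L := by nlinarith
  have hβpos : 0 < β := by linarith
  have hSle := inv_sq_mul_sum_inv_dispersion_le (L := L) hev h4
  have hSβ : 1 / (L : ℝ) ^ 2 * ∑ k ∈ Finset.univ.erase (0 : TorusSite 2 L),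
      1 / dispersion (latticeMomentum L k) ≤ β := by linarith
  have hkey : (2 : ℝ) / (4 * β) * (1 / (L : ℝ) ^ 2 * ∑ k ∈ Finset.univ.erase (0 : TorusSite 2 L),
      1 / dispersion (latticeMomentum L k)) ≤ 1 / 2 := by
    rw [div_mul_eq_mul_div, div_le_iff₀ (by positivity)]
    linarith
  have hfact := (FriedliVelenik2017_nVector_infraredBound_holds 2 L 2 hev h4 ρ hK hρ β hβpos).2 hS
  simp only [Nat.cast_ofNat] at hfact
  linarith

end Summit.HubbardSuperconductivity.HubbardSuperconductivity.Theorems.LogColdTorus
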